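import Mathlib
import HarnessLib
import HarnessLib.Audit
import Summits.AtomisticToContinuum.Statement
import Literature.MathematicalPhysics.QuantumManyBody.PeriodicBoseGas
import Literature.MathematicalPhysics.QuantumManyBody.PeriodicBoseGasFourier
import Literature.MathematicalPhysics.QuantumLattice.HeisenbergModel
import Literature.MathematicalPhysics.QuantumLattice.LatticeTori
import HarnessLib.Audit.Status.Attr

/-!
Route: BECGroundStateSOS

DORMANT since 2026-08-25T00:37:52Z (reconciler: no traction for 7.2 d (last activity item-evidence-added at 2026-08-17T18:55:01Z); parked, not closed — `ledger route dormant route-AtomisticToContinuum-BECGroundStateSOS --off` to reactiv) — unstaffed, not closed; items shared with open routes are served there. `ledger route dormant <id> --off` reactivates.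

# Route BECGroundStateSOS — ground-state Positivstellensatz: SOS certificates in the cone ω(A*[H,A])
≥ 0 replace Gaussian domination in the KLS infrared bound

It suffices to show X = PeriodicIRBound, the T = 0 INFRARED BOUND AT LOW MOMENTA ON THE TORUS: for
every repulsive finite-range v and every
κ > 0 there are ρ₀ > 0 and C such that for 0 < ρ < ρ₀, all large N, some δ > 0 and every
δ-near-minimiser Ψ of the PERIODIC N-body energy on
the torus of side L = (N/ρ)^{1/3}, every plane wave φ_k = L^{-3/2} e^{2πik·x/L}, k ∈ ℤ³∖{0} with ‖k‖
≤ κ√ρ·L, has occupation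
⟨φ_k, γ_Ψ φ_k⟩ ≤ C√ρ·L/‖k‖ (the Gaussian-domination shape 1/√ε(p), p = 2πk/L, of
Kennedy–Lieb–Shastry, in the Goldstone window |p| ≲ κ√ρ only;
no UV branch). Realises card sos-infrared-certificates (and the merged duplicate
gs-sdp-certificate-rp-free): X is to be PROVED by exhibiting,
for each k, a sum-of-squares certificate in the ground-state positivity cone — an operator identity
C√ρL/‖k‖ − n_k = Σ_j B_j*B_j + Σ_i A_i*[H,A_i]
+ (symmetry terms), found by translation-invariant ground-state SDP on the lattice benchmark (crux
LatticeODLROOffHalfFilling) and rationalised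
into a closed k-family. Given X, BEC follows on the torus by mode counting (support IRModeCounting,
resting on the PROVED fact
LSSY2005_upperBound_periodic_holds) and in the audited Dirichlet form by the shared transfer crux
BoundaryTransferWeak (= stmt-AtomisticToContinuum-0827).
Lean: `∀ v : ℝ → ENNReal,
Literature.MathematicalPhysics.QuantumManyBody.BoseGas.IsRepulsiveFiniteRange v → ∀ κ : ℝ, 0 < κ → ∃
ρ₀ : ℝ, 0 < ρ₀ ∧ ∃ C : ℝ, 0 < C ∧ ∀ ρ : ℝ, 0 < ρ → ρ < ρ₀ → ∀ᶠ N : ℕ in Filter.atTop, ∃ δ : ENNReal,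
0 < δ ∧ ∀ Ψ : Literature.MathematicalPhysics.QuantumManyBody.BoseGas.PeriodicTrialState N
(Literature.MathematicalPhysics.QuantumManyBody.BoseGas.sideLength ρ N),
Literature.MathematicalPhysics.QuantumManyBody.BoseGas.periodicEnergy v Ψ ≤
Literature.MathematicalPhysics.QuantumManyBody.BoseGas.periodicGroundStateEnergy v N
(Literature.MathematicalPhysics.QuantumManyBody.BoseGas.sideLength ρ N) + δ → ∀ k : Fin 3 → ℤ, k ≠ 0
→ ‖(fun j => (k j : ℝ))‖ ≤ κ * Real.sqrt ρ *
Literature.MathematicalPhysics.QuantumManyBody.BoseGas.sideLength ρ N →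
Literature.MathematicalPhysics.QuantumManyBody.BoseGas.cellOccupation N
(Literature.MathematicalPhysics.QuantumManyBody.BoseGas.sideLength ρ N) (fun x => ((Real.sqrt
(Literature.MathematicalPhysics.QuantumManyBody.BoseGas.sideLength ρ N ^ 3))⁻¹ : ℂ) *
Literature.MathematicalPhysics.QuantumManyBody.BoseGas.cellWave
(Literature.MathematicalPhysics.QuantumManyBody.BoseGas.sideLength ρ N) k x) Ψ.ψ ≤ ENNReal.ofReal (C
* Real.sqrt ρ * Literature.MathematicalPhysics.QuantumManyBody.BoseGas.sideLength ρ N / ‖(fun j =>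
(k j : ℝ))‖)`

## Assembly
Pure logic (term-mode, rc 0 in Sketch.lean: `fun hF hX hMC hBT v hv => hBT v hv ((hMC hF hX) v
hv)`): finiteness and X give PeriodicBEC by the
mode-counting glue, and the shared boundary-condition transfer turns PeriodicBEC(v) into
HasGroundStateBEC v ρ for all small ρ, i.e. the conjunct.
The lattice crux is the mechanism's proving ground and first deliverable (the certificate family is
searched, rationalised and kill-tested THERE,
then transplanted to X); it is deliberately not a logical antecedent of X — no lattice-to-continuum
limit theorem is claimed at open.

Rationale: WHY THIS LINE. Infinite-volume ground states are exactly the states with ω(A*[H,A]) ≥ 0 for all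
local A (Bratteli–Robinson II Def. 5.3.18 / Prop. 5.3.19), so a linear bound ω(O) ≥ c
holds in every translation-invariant ground state iff (up to closure) O − c·1 = Σ B_j*B_j + Σ
A_i*[H,A_i] + i[H,C] + Σ(D_l − τD_l) — a Positivstellensatz
certificate; the NPA/state-optimality SDP hierarchies (AraujoEtAl2026, KullEtAl2024,
FawziFawziScalet2024, WangEtAl2024) search exactly this dual cone.
The only thermodynamic-limit proof of interacting BEC, Kennedy–Lieb–Shastry (KLS1988PRL, KLS1988JSP;
LSSY2005 Ch. 11; PROVED in the tree:
kennedy_lieb_shastry_xy_ground_holds via kls_xy_gaussianDomination_ground →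
kls_xy_infraredBound_ground), is such a certificate chain whose single
non-algebraic input is Gaussian domination from reflection positivity, lost off half filling and in
the continuum (barrier HalfFillingReflectionPositivity).
The line treats "find the Gaussian-domination substitute" as a convex feasibility problem with
momentum k as a symbolic parameter: search the cone by
translation-invariant ground-state SDP — enlarged by the defect/flux-threaded constraint sets of
ScheerEtAl2025, which are licensed for bosons by the
diamagnetic inequality ("defect diamagnetism") — first for hard-core lattice bosons at chemical
potential μ ≠ 0 (open since 1988), rationalise the
numerical duals into a closed k-family (exact arithmetic + interpolation in cos pᵢ, spin-wave ansatz
A_k ~ ε(k)⁻¹×phase mode), then transplant the analytic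
form to the continuum torus as X. Imported areas: real algebraic geometry / noncommutative
polynomial optimisation (SOS duality), lattice statistical
mechanics (KLS architecture), computer-assisted proof; the output is a finite identity checkable in
Lean by normal ordering. No prior route has a
mechanism for the infrared bound (BECInfraredBound files it undecomposed, Dirichlet, and is
blocked); negatives index empty.

RANKED CRUXES. #2 LatticeODLROOffHalfFilling (crux) — LATTICE BENCHMARK (card crux F+U): hard-core
lattice bosons OFF half filling condense at T = 0 in d = 3 — there is μ₀ > 0 such that for |μ| < μ₀
the tracial ground states of H_{L,μ} = −Σ_{⟨xy⟩}(S¹_xS¹_y + S²_xS²_y) − μ Σ_x S³_x (S = 1/2 XY model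
in a uniform field = hard-core bosons at chemical potential μ) on the even tori (ℤ/2kℤ)³ have
off-diagonal long-range order, liminf_k |Λ|⁻² Σ_{x,y} Re ω(S¹_xS¹_y + S²_xS²_y) > 0. μ = 0 is KLS
(proved in tree); the content is μ ≠ 0, where reflection positivity is lost (LSSY2005 Ch. 11 §11.1:
"no one has so far found a way"). To be proved by the mechanism: a k-uniform family of bounded-range
SOS certificates for the μ-deformed KLS infrared bound (A_μ) ĝ¹_q² E_q ≤ ¼Σᵢ(e₁ − e₃ cos qᵢ)(1 +
O(μ)), then the in-tree KLS assembly (sum rule, e₁ ≥ S²/2 − O(μ), I(3) = 0.35 < 1/√2 leaves slack).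
[difficulty: open-problem] (why it might fail: As a statement expected true (open since 1988); the
MECHANISM fails if Goldstone physics forces certificate range → ∞ as q → 0 (susceptibility ladder:
each SDP level buys a fixed factor in q) — then no finite k-family exists even AT half filling.)
[KLS1988PRL, KLS1988JSP, LSSY2005, AizenmanEtAl2004, ScheerEtAl2025, WangEtAl2024, AraujoEtAl2026]
#3 PeriodicIRBound (crux) — X (card item X_D, torus form): the T = 0 infrared bound n_Ψ(k) ≤
C√ρ·L/‖k‖ for all plane waves 0 < ‖k‖ ≤ κ√ρ·L (any κ, C = C(v,κ) uniform in ρ < ρ₀ and N) for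
δ-near-minimisers of the periodic N-body energy at L = (N/ρ)^{1/3}. Periodic states and the
low-momentum window avoid both defects refuters found in the Dirichlet item stmt-0733 (wall boundary
layer; sharp-window k⁻⁴ artefact); true at v ≡ 0 (n_k ≤ δL²/4π²‖k‖² with δ(N) small), so no a > 0
hypothesis is needed. To be proved as the continuum transplant of the lattice certificate family
(quadratic-form identity on C¹ periodic states; ω(A*[H,A]) ≥ −O(√δ) for near-minimisers by
Cauchy–Schwarz in the form of H − E₀). [deps: LatticeODLROOffHalfFilling] [difficulty: open-problem]
(why it might fail: No RP and no uniform gap at L = (N/ρ)^{1/3}; lattice certificates may have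
constants blowing up with the spacing; a collective phase branch giving some δ-near-minimiser n_k ≫
√ρL/‖k‖ at ‖k‖ ~ 1 would refute it (v ≡ 0 and single-mode injections do not).) [LSSY2005,
Fournais2020, KLS1988JSP, DysonLiebSimon1978, stmt-AtomisticToContinuum-0733]
#4 BoundaryTransferWeak (crux) — SHARED with route BECPeriodicReduction
(stmt-AtomisticToContinuum-0827, verbatim): for each repulsive finite-range v, constant-mode BEC for
periodic near-minimisers at all small ρ implies the audited Dirichlet, mode-free HasGroundStateBEC v
ρ at all small ρ. [difficulty: L] (why it might fail: Torus BEC is ground-state-only (δ after N)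
while Dirichlet/periodic energies differ by a wall term ≫ N/L²; interior restrictions are neither
periodic nor of sharp N, so the hypothesis may never fire (see 0827 notes; Robinson1976: BEC can be
BC-sensitive).) [LSSY2005, Fournais2020, stmt-AtomisticToContinuum-0827]
#9 IRModeCounting (support) — MODE COUNTING ON THE TORUS: PeriodicEnergyFinite → PeriodicIRBound →
PeriodicBEC (body of stmt-AtomisticToContinuum-0826 inlined). Proof: Plancherel per co-ordinate
slice (in tree: tsum_sq_cellFourierCoeff, tsum_sq_grad_cellFourierCoeff) gives Σ_k n_k = N and Σ_k
(2π‖k‖₂/L)² n_k = T ≤ E₀^per + δ ≤ 8πaρN (PROVED LSSY2005_upperBound_periodic_holds; a = scattering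
length ≤ R₀); UV tail Σ_{‖k‖>κ√ρL} n_k ≤ T·L²/(4π²κ²ρL²) ≤ 2aN/(πκ²) ≤ N/16 for κ = κ(a); IR window
Σ_{0<‖k‖≤κ√ρL} C√ρL/‖k‖ ≤ 14Cκ²√ρ·N ≤ N/16 for ρ small; hence n₀ ≥ N/2. [difficulty: M] [KLS1988PRL,
LSSY2005, Fournais2020]
#9 PeriodicEnergyFinite (support) — FINITENESS: for repulsive finite-range v (range R₀) there is ρ₀
> 0 with E₀^per(N, (N/ρ)^{1/3}) < ⊤ for ρ < ρ₀ and all large N (N bumps at mutual torus distance >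
R₀; or directly from LSSY2005_upperBound_periodic_holds once scatteringLength v ≠ ⊤, cf.
stmt-AtomisticToContinuum-0851). Needed to subtract in ℝ≥0∞ and to make the near-minimiser
hypotheses non-vacuous. [difficulty: provable-now] [LSSY2005]

TWO-LAYER PLAN. Foreseen glued splits (nothing filed now): LatticeODLROOffHalfFilling ⇐
LatticeIRBoundMu (the μ-deformed (A): ĝ¹_q²E_q ≤ ¼Σᵢ(e₁−e₃cos qᵢ)(1+C|μ|),
q ≠ 0, even L ≥ 4) → LatticeKLSAssemblyMu (in-tree KLS assembly rerun with μ-corrected sum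
rule/Kubo/variational bounds) → LatticeODLROOffHalfFilling;
PeriodicIRBound ⇐ ContinuumCertificate (the quadratic-form identity family on C¹ periodic states) →
NearMinimiserSoundness (ω(A*[H,A]) ≥ −C√δ·‖A‖-type
bookkeeping, δ(N) → 0) → PeriodicIRBound. Lemmas below that (normal-ordering identities, lattice
sums) ride with --supports.

KILL CRITERIA. (K1) Level-vs-k scan AT half filling (μ = 0, where KLS holds): if the
translation-invariant ground-state SDP with all operators of range ≤ R (plus defect/flux
constraints) certifies ĝ¹_q ≤ c/√E_q only down to some q_*(R) > 0 for every range R tested, q_*(R)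
shrinking only as R grows (no finite R certifies all q ≠ 0 on 2-D/3-D tori
L ≤ 8–12), the mechanism (finite k-uniform family) is dead: close `--reason exhausted` with the scan
as census (the STATEMENTS stay open for other lines). (K2) A refutation of
PeriodicIRBound (some admissible v, near-minimisers with n_k ≫ √ρL/‖k‖ at ‖k‖ ~ 1 for all small ρ)
closes the route `refuted:PeriodicIRBound` and also
kills BECInfraredBound's line. (K3) ¬BoundaryTransferWeak kills this assembly (pivot: Dirichlet
inner-box mode counting, items 0734/0735 repaired) but not X.
(K4) PeriodicBEC proved elsewhere moots IRModeCounting/X for the conjunct (the lattice crux keeps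
its own value).

NOT DECOMPOSED YET. The certificate form itself (which operator basis: one- and two-site polynomials
at fixed total momentum, flux-threaded/defect ancillas, inter-mode
stationarity identities — single-mode moment data provably cannot bound n_k from above, a
Hankel-moment no-go carried over from the merged card);
the rationalisation step (numerical dual → exact k-family); constants in the μ-deformed KLS chain;
the lattice→continuum transplant (CCR quadratic forms
vs. a Bose–Hubbard discretisation with spacing-uniform constants); d = 2 and positive temperature;
the Dirichlet inner-box alternative to BoundaryTransferWeak.

CHEAPEST FALSIFIER. K1 above on the 2-D torus first (KLS holds at T = 0 in d = 2, SDPs are cheapest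
there): momentum-block-diagonalised TI ground-state SDP for the S = 1/2 XY
model on L = 4, 6, 8 with range-2 then range-3 operators; objective = max ĝ¹_q at the smallest q ≠
0; compare the certified bound with the KLS value
½[Σ(e₁−e₃cos qᵢ)/Σ(1−cos qᵢ)]^{1/2}. If range 2 → 3 does not improve the smallest-q bound at fixed
L, stop (level-2→3 stopping rule). Not run here (planner
seat, no kit in plancard mode); it is the first job for whoever claims LatticeODLROOffHalfFilling
(attach as evidence kind computation).

NUMBERS. KLS: ĝ¹_p ≤ ½[Σᵢ(e₁−e₃cos pᵢ)/Σᵢ(1−cos pᵢ)]^{1/2} (KLS1988PRL eq. (4)); I(2) = 0.65, I(3) =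
0.35 vs threshold 2S/√2 = 1/√2 ≈ 0.707 for S = 1/2 (slack factor 2
in d = 3); ALSSY staggered-field threshold λ ≲ 0.960 in d = 3 (LSSY2005 (11.26)–(11.27)); saturation
field of H_{L,μ} is |μ| = 3 (dilute lattice gas
as |μ| → 3⁻). Continuum: Bogoliubov n_p ≈ √(πρa)·O(1)/|p| for |p| ≲ (8πρa)^{1/2}, (4πρa)²/4p⁴
beyond; E₀^per ≤ 4πρ₁aN(1 + C a/b) (LSSY2005 Thm 2.2, proved
in tree); UV Markov tail ≤ 2aN/(πκ²). Items at open: 6 (3 cruxes incl. 1 shared, 2 support, 1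
assembly).

DEFINITION REQUESTS. None at open:
Op/siteSpin/totalSpin/xyTorus/Matrix.groundStateFunctional/HasEvenTorusLRO (QuantumLattice),
PeriodicTrialState/periodicEnergy/
cellOccupation/cellWave (PeriodicBoseGas, PeriodicBoseGasFourier) exist. Later (tenure): a notion
`GroundStateSOSCertificate` (bounded-range certificate
family for a TI lattice Hamiltonian, over IsSupportedOn) if the certificate-existence statement is
to be typed as its own item.

Novelty: Searches (2026-08-15, this seat, on top of the card's log and refuter audits 12/13): `lit search
--hybrid "hard core bosons away from half filling …
without reflection positivity"` (10 book hits, LSSY2005 Ch. 11 only relevant); `lit search --source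
crossref "long-range order hard core bosons lattice
chemical potential proof infrared bound"` (12: QMC/supersolid numerics, no theorem); `--source
crossref "quantum many-body bootstrap semidefinite long-range
order symmetry breaking thermodynamic limit" --year-from 2022` (15, none relevant); `lit galaxy
search "many-body bootstrap" | "certified bounds on
ground-state" | "sum of squares certificate long-range order …" --star all` (1 hit: arXiv:2507.02386
Huang–Li, Bloch-periodic bootstrap, no LRO;
galaxy partly saturated); arXiv/S2/OpenAlex/zbMATH APIs rate-limited (429) this session; `lit read
arXiv:2511.20860` pp. 1–2 (read).
Nearest prior art found: ScheerEtAl2025 (arXiv:2511.20860, defect bootstrap: rigorous SDP lower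
bounds on ⟨Z₀Z_r⟩ in SSB phases directly in the
thermodynamic limit, discrete symmetry worked out, continuous symmetry covered only by the "defect
diamagnetism" criterion); WangEtAl2024
(arXiv:2310.05844, certified ground-state correlations, LRO bounds loosen with L); AraujoEtAl2026 /
KullEtAl2024 / FawziFawziScalet2024 (the cone and
TI relaxations); KLS1988PRL/KLS1988JSP (the certificate chain with RP input).
Delta: nobody has pointed the ground-state SOS dual at the ONE reflection-positivity input of KLS
with mom  [refs: 2507.02386, 2511.20860, 2310.05844, LSSY2005, ScheerEtAl2025, WangEtAl2024, AraujoEtAl2026, KullEtAl2024, FawziFawziScalet2024]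

Barriers (technique_class: sos-certificate, infrared-bound, gs-positivity-cone): - technique_class: sos-certificate, infrared-bound, gs-positivity-cone
- Literature.Barriers.AtomisticToContinuum.HalfFillingReflectionPositivity: attacked head-on, not
evaded — its Narrow companion proves site-local RP of the STATE forces ⟨N⟩ = |Λ|/2, so the
substitute for Gaussian domination must avoid reflection positivity of the state altogether:
certificates use only ω(A*[H,A]) ≥ 0, stationarity and translation invariance, none of which sees
particle–hole symmetry; kill signal K1 lives at half filling itself.
- Literature.Barriers.AtomisticToContinuum.KineticGapLengthScales: evaded in form (no
L²×excess-energy step; near-minimiser slack δ(N) is chosen after N and enters only as O(√δ) in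
ω(A*[H,A]) ≥ −O(√δ)); it re-enters honestly as the susceptibility ladder (certificate range vs.
1/q), which is exactly K1.
- Literature.Barriers.AtomisticToContinuum.EnergyAsymptoticsWithoutCondensation: evaded — the full
cone {ω(A*[H,A]) ≥ 0 ∀ local A} is used, of which the energy is one functional; the glue uses the
energy only for the trivial UV Markov tail.
- Literature.Barriers.AtomisticToContinuum.BogoliubovPerturbationInfrared: not an expansion — a
certificate is a finite identity valid non-perturbatively; Bogoliubov theory enters only as the
ansatz for rationalising the dual (A_k ~ ε(k)⁻¹ × phase mode).
- Literature.Barriers.AtomisticToContinuum.CasimirBoxGeneralizedCondensation: the window ‖k‖ ≤ κ√ρL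
with C uniform in k, ρ, N plus Parseval pins the single ZERO mode (n₀ ≥ N/2), no

History (route lifecycle, newest last):
- 2026-08-15T11:30:23Z · rev 1: restated IRModeCounting (stmt-AtomisticToContinuum-3973) — inline PeriodicEnergyFinite and PeriodicIRBound bodies into IRModeCounting (gate wrote it as TODO: forward reference to PeriodicEnergyFinite) (planner-plancard-AtomisticToContinuum-BoseEin-87119127-0)
- 2026-08-15T11:40:28Z · rev 3: restated Assembly (stmt-AtomisticToContinuum-3975) — emit Assembly (was sticky TODO from rev 0 forward-ref): same chain, target spelled as the audited sub-problem abbrev _root_.BoseEinsteinCondensation (defeq to t (planner-plancard-AtomisticToContinuum-BoseEin-87119127-0)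
- 2026-08-15T16:35:51Z · rev 6: restated LatticeODLROOffHalfFilling (stmt-AtomisticToContinuum-3971) — cone repair (rrepair g2): the 4 unproved facts in the import cone were the four `[cite pending]` Mermin–Wagner facts (QuantumLattice.mermin_wagner{,_staggered,_ (planner-rrepair-AtomisticToContinuum-BECGround-67de3bb1-g2-0)
- 2026-08-25T00:37:52Z · DORMANT — reconciler: no traction for 7.2 d (last activity item-evidence-added at 2026-08-17T18:55:01Z); parked, not closed — `ledger route dormant route-AtomisticToConti (operator:999:430597)

sub-problem: BoseEinsteinCondensation · status: dormant · opened planner-plancard-AtomisticToContinuum-BoseEin-87119127-0 2026-08-15T11:26:41Z · rev 6 · ledger route-AtomisticToContinuum-BECGroundStateSOS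
GENERATED by the gate from the ledger (D-0016/17). Provers cite these decls: `theorem foo : Summit.AtomisticToContinuum.BoseEinsteinCondensation.Theses.BECGroundStateSOS.<Decl> := …` in Summits/AtomisticToContinuum/BoseEinsteinCondensation/Theorems/<Name>.lean.
-/

namespace Summit.AtomisticToContinuum.BoseEinsteinCondensation.Theses.BECGroundStateSOS

open scoped BigOperators Topology Manifold Classical MeasureTheory ProbabilityTheory Matrix InnerProductSpace ComplexConjugate ContinuousMap
open Filter Set Function TopologicalSpace MeasureTheory

attribute [summit_statement] _root_.BoseEinsteinCondensation

-- earlier LatticeODLROOffHalfFilling (stmt-AtomisticToContinuum-3971, replaced 2026-08-15T16:35:51Z -> stmt-AtomisticToContinuum-11033): retired by None — ∃ μ₀ : ℝ, 0 < μ₀ ∧ ∀ μ : ℝ, |μ| < μ₀ → Literature.MathematicalPhysics.QuantumLattice.HasEvenTorusLRO (d := 3) (fun L x y => if hL : L = 0 then 0 else (haveI : NeZero L := ⟨hL⟩; (∑ α : Fin 2, (Literature.MathematicalPhysics.QuantumLattice.xyTorus 3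
/-- item stmt-AtomisticToContinuum-11033 · crux · rank 2 · open · by planner
why it might fail: Open since KLS1988 (LSSY2005 §11.1 p.117): for μ ≠ 0 the particle–hole symmetry behind RP/Gaussian domination is gone (HalfFillingReflectionPositivityNarrow), no other continuous-symmetry LRO engine exists; the SOS mechanism dies if certifying ĝ_q ≤ c/√E_q needs certificate range → ∞ as q → 0 (K1).
sources: KLS1988PRL, KLS1988JSP, LSSY2005, AizenmanEtAl2004, ScheerEtAl2025, WangEtAl2024
[crux] LATTICE BENCHMARK (card crux F+U): hard-core lattice bosons OFF half filling condense at T =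
0 in d = 3 — there is μ₀ > 0 such that for |μ| < μ₀ the tracial ground states of H_{L,μ} =
−Σ_{⟨xy⟩}(S¹_xS¹_y + S²_xS²_y) − μ Σ_x S³_x (S = 1/2 XY model in a uniform field = hard-core bosons
at chemical potential μ; Lean: xxzHamiltonian 1 (torusGraph 3 L) (−1) 0 − μ·totalSpin 1 2) on the
even tori (ℤ/2kℤ)³ have off-diagonal long-range order, liminf_k |Λ|⁻² Σ_{x,y} Re ω(S¹_xS¹_y +
S²_xS²_y) > 0 (written as the liminf over halfOpenBox 3 (2k) of the torusPullback — the unfolded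
form of HasEvenTorusLRO, cf. hasEvenTorusLRO_iff = Iff.rfl). μ = 0 is KLS (proved in tree:
kennedy_lieb_shastry_xy_ground_holds); the content is μ ≠ 0, where reflection positivity is lost
(LSSY2005 Ch. 11 §11.1: "no one has so far found a way"). To be proved by the mechanism: a k-uniform
family of bounded-range SOS certificates for the μ-deformed KLS infrared bound (A_μ) ĝ¹_q² E_q ≤
¼Σᵢ(e₁ − e₃ cos qᵢ)(1 + O(μ)), then the in-tree KLS assembly (sum rule, e₁ ≥ S²/2 − O(μ), I(3) =
0.35 < 1/√2 leaves slack). RESTATED 2026-08-15 (cone repair, rev 6): same proposition as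
stmt-AtomisticToContinuum-3971 with `xyTorus`/`H -/
@[route_item "route-AtomisticToContinuum-BECGroundStateSOS", crux]
def LatticeODLROOffHalfFilling : Prop :=
  ∃ μ₀ : ℝ, 0 < μ₀ ∧ ∀ μ : ℝ, |μ| < μ₀ → 0 < Filter.liminf (fun k : ℕ => (∑ x ∈ Literature.Probability.LatticeModels.halfOpenBox 3 (2 * k), ∑ y ∈ Literature.Probability.LatticeModels.halfOpenBox 3 (2 * k), Literature.MathematicalPhysics.QuantumLattice.torusPullback (d := 3) (fun L x y => if hL : L = 0 then 0 else (haveI : NeZero L := ⟨hL⟩; (∑ α : Fin 2, (Literature.MathematicalPhysics.QuantumLattice.xxzHamiltonian 1 (Literature.Probability.LatticeModels.torusGraph 3 L) (-1) 0 - (μ : ℂ) • Literature.MathematicalPhysics.QuantumLattice.totalSpin 1 2).groundStateFunctional (Literature.MathematicalPhysics.QuantumLattice.siteSpin 1 x (Fin.castSucc α) * Literature.MathematicalPhysics.QuantumLattice.siteSpin 1 y (Fin.castSucc α))).re)) (2 * k) x y) / ((Literature.Probability.LatticeModels.halfOpenBox 3 (2 * k)).card : ℝ) ^ 2) Filter.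atTop

/-- item stmt-AtomisticToContinuum-3972 · crux · rank 3 · open · by planner
why it might fail: Open-problem strength: an N-uniform IR bound gives thermodynamic-limit BEC (LSSY2005 p.35; proofs stop at L ~ ρ^{-1/2}(ρa³)^{-η}: Fournais2020 Thm 1.2, Junge2026). No RP/uniform gap at L=(N/ρ)^{1/3}; lattice certificates may lose constants with the spacing; n_k ≫ √ρL/‖k‖ at ‖k‖~1 would refute.
sources: LSSY2005, Fournais2020, Junge2026, KLS1988JSP, DysonLiebSimon1978, Literature.Barriers.AtomisticToContinuum.KineticGapLengthScales
[crux] X (card item X_D, torus form): the T = 0 infrared bound n_Ψ(k) ≤ C√ρ·L/‖k‖ for all plane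
waves 0 < ‖k‖ ≤ κ√ρ·L (any κ, C = C(v,κ) uniform in ρ < ρ₀ and N) for δ-near-minimisers of the
periodic N-body energy at L = (N/ρ)^{1/3}. Periodic states and the low-momentum window avoid both
defects refuters found in the Dirichlet item stmt-0733 (wall boundary layer; sharp-window k⁻⁴
artefact); true at v ≡ 0 (n_k ≤ δL²/4π²‖k‖² with δ(N) small), so no a > 0 hypothesis is needed. To
be proved as the continuum transplant of the lattice certificate family (quadratic-form identity on
C¹ periodic states; ω(A*[H,A]) ≥ −O(√δ) for near-minimisers by Cauchy–Schwarz in the form of H −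
E₀). [deps: LatticeODLROOffHalfFilling] [difficulty: open-problem] -/
@[route_item "route-AtomisticToContinuum-BECGroundStateSOS", crux]
def PeriodicIRBound : Prop :=
  ∀ v : ℝ → ENNReal, Literature.MathematicalPhysics.QuantumManyBody.BoseGas.IsRepulsiveFiniteRange v → ∀ κ : ℝ, 0 < κ → ∃ ρ₀ : ℝ, 0 < ρ₀ ∧ ∃ C : ℝ, 0 < C ∧ ∀ ρ : ℝ, 0 < ρ → ρ < ρ₀ → ∀ᶠ N : ℕ in Filter.atTop, ∃ δ : ENNReal, 0 < δ ∧ ∀ Ψ : Literature.MathematicalPhysics.QuantumManyBody.BoseGas.PeriodicTrialState N (Literature.MathematicalPhysics.QuantumManyBody.BoseGas.sideLength ρ N), Literature.MathematicalPhysics.QuantumManyBody.BoseGas.periodicEnergy v Ψ ≤ Literature.MathematicalPhysics.QuantumManyBody.BoseGas.periodicGroundStateEnergy v N (Literature.MathematicalPhysics.QuantumManyBody.BoseGas.sideLength ρ N) + δ → ∀ k : Fin 3 → ℤ, k ≠ 0 → ‖(fun j => (k j : ℝ))‖ ≤ κ * Real.sqrt ρ * Literature.MathematicalPhysics.QuantumManyBody.BoseGas.sideLength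 ρ N → Literature.MathematicalPhysics.QuantumManyBody.BoseGas.cellOccupation N (Literature.MathematicalPhysics.QuantumManyBody.BoseGas.sideLength ρ N) (fun x => ((Real.sqrt (Literature.MathematicalPhysics.QuantumManyBody.BoseGas.sideLength ρ N ^ 3))⁻¹ : ℂ) * Literature.MathematicalPhysics.QuantumManyBody.BoseGas.cellWave (Literature.MathematicalPhysics.QuantumManyBody.BoseGas.sideLength ρ N) k x) Ψ.ψ ≤ ENNReal.ofReal (C * Real.sqrt ρ * Literature.MathematicalPhysics.QuantumManyBody.BoseGas.sideLength ρ N / ‖(fun j => (k j : ℝ))‖)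

/-- item stmt-AtomisticToContinuum-0827 · crux · rank 4 · open · by planner
why it might fail: Torus BEC is ground-state-only (δ after N); the Dirichlet GS lies a wall term ≫ δ above E₀^per, interior restrictions are neither periodic nor sharp-N, so it may never fire; only the ENERGY is BC-independent in print (LSSY2005 Ch.2 after (2.8)); Neumann bracketing + mode-free step unproved.
sources: LSSY2005, Basti2022, BoccatoSeiringer2023, Junge2026, Fournais2020, Literature.MathematicalPhysics.QuantumManyBody.BoseGas.LSSY2005_e0_periodic_eq_dirichlet_offCritical
[crux] BoundaryTransferWeak (mode-free boundary-condition transfer, per potential): for each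
repulsive finite-range v, PeriodicBEC(v) implies ∃ρ₀>0 ∀ρ∈(0,ρ₀) HasGroundStateBEC v ρ (Dirichlet
ground state, λ_max(γ) ≥ cN via condensateNumber). Not glue: near-minimiser slacks are O(N/L²) while
Dirichlet/periodic energies differ by a boundary term ≫ N/L², so no energy-comparison proof;
expected route: Neumann bracketing of interior sub-boxes (−Δ_Dir ≥ ⊕−Δ_Neu, v ≥ 0) + a mode-free
criterion (λ_max ≥ tr γ²/N). Only the ENERGY analogue is in print (LiebSeiringerSolovejYngvason2005
Ch. 2 after (2.8)). v ≡ 0: hypothesis and conclusion both true. -/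
@[route_item "route-AtomisticToContinuum-BECGroundStateSOS", crux]
def BoundaryTransferWeak : Prop :=
  ∀ v : ℝ → ENNReal, Literature.MathematicalPhysics.QuantumManyBody.BoseGas.IsRepulsiveFiniteRange v → (∃ ρ₀ : ℝ, 0 < ρ₀ ∧ ∀ ρ : ℝ, 0 < ρ → ρ < ρ₀ → ∃ c : ℝ, 0 < c ∧ ∀ᶠ N : ℕ in Filter.atTop, ∃ δ : ENNReal, 0 < δ ∧ ∀ Ψ : Literature.MathematicalPhysics.QuantumManyBody.BoseGas.PeriodicTrialState N (Literature.MathematicalPhysics.QuantumManyBody.BoseGas.sideLength ρ N), Literature.MathematicalPhysics.QuantumManyBody.BoseGas.periodicEnergy v Ψ ≤ Literature.MathematicalPhysics.QuantumManyBody.BoseGas.periodicGroundStateEnergy v N (Literature.MathematicalPhysics.QuantumManyBody.BoseGas.sideLength ρ N) + δ → ENNReal.ofReal (c * N) ≤ Literature.MathematicalPhysics.QuantumManyBody.BoseGas.condensateOccupation N (Literature.MathematicalPhysics.QuantumManyBody.BoseGas.sideLength ρ N) Ψ.ψ) → ∃ ρ₀ : ℝ, 0 < ρ₀ ∧ ∀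 ρ : ℝ, 0 < ρ → ρ < ρ₀ → Literature.MathematicalPhysics.QuantumManyBody.BoseGas.HasGroundStateBEC v ρ

/-- item stmt-AtomisticToContinuum-3974 · support · rank 9 · closed · proved by Summit.AtomisticToContinuum.BoseEinsteinCondensation.Theorems.periodicEnergyFinite_proof (prover) · by planner
sources: LSSY2005
[support] FINITENESS: for repulsive finite-range v (range R₀) there is ρ₀ > 0 with E₀^per(N,
(N/ρ)^{1/3}) < ⊤ for ρ < ρ₀ and all large N (N bumps at mutual torus distance > R₀; or directly from
LSSY2005_upperBound_periodic_holds once scatteringLength v ≠ ⊤, cf. stmt-AtomisticToContinuum-0851).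
Needed to subtract in ℝ≥0∞ and to make the near-minimiser hypotheses non-vacuous. [difficulty:
provable-now] -/
@[route_item "route-AtomisticToContinuum-BECGroundStateSOS", crux]
def PeriodicEnergyFinite : Prop :=
  ∀ v : ℝ → ENNReal, Literature.MathematicalPhysics.QuantumManyBody.BoseGas.IsRepulsiveFiniteRange v → ∃ ρ₀ : ℝ, 0 < ρ₀ ∧ ∀ ρ : ℝ, 0 < ρ → ρ < ρ₀ → ∀ᶠ N : ℕ in Filter.atTop, Literature.MathematicalPhysics.QuantumManyBody.BoseGas.periodicGroundStateEnergy v N (Literature.MathematicalPhysics.QuantumManyBody.BoseGas.sideLength ρ N) ≠ ⊤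

-- earlier IRModeCounting (stmt-AtomisticToContinuum-3973, replaced 2026-08-15T11:30:23Z -> stmt-AtomisticToContinuum-4246): retired by None — PeriodicEnergyFinite → PeriodicIRBound → ∀ v : ℝ → ENNReal, Literature.MathematicalPhysics.QuantumManyBody.BoseGas.IsRepulsiveFiniteRange v → ∃ ρ₀ : ℝ, 0 < ρ₀ ∧ ∀ ρ : ℝ, 0 < ρ → ρ < ρ₀ → ∃ c : ℝ, 0 < c ∧ ∀ᶠ N : ℕ in Filter.atTop, ∃ δ : ENNReal, 0 < δ ∧ ∀ Ψ : L
/-- item stmt-AtomisticToContinuum-4246 · support · rank 9 · closed · proved by Summit.AtomisticToContinuum.BoseEinsteinCondensation.Theorems.IRModeCounting_proof (prover) · by planner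
sources: KLS1988PRL, LSSY2005, Fournais2020
[support] MODE COUNTING ON THE TORUS: PeriodicEnergyFinite → PeriodicIRBound → PeriodicBEC (body of
stmt-AtomisticToContinuum-0826 inlined). Proof: Plancherel per co-ordinate slice (in tree:
tsum_sq_cellFourierCoeff, tsum_sq_grad_cellFourierCoeff) gives Σ_k n_k = N and Σ_k (2π‖k‖₂/L)² n_k =
T ≤ E₀^per + δ ≤ 8πaρN (PROVED LSSY2005_upperBound_periodic_holds; a = scattering length ≤ R₀); UV
tail Σ_{‖k‖>κ√ρL} n_k ≤ T·L²/(4π²κ²ρL²) ≤ 2aN/(πκ²) ≤ N/16 for κ = κ(a); IR window Σ_{0<‖k‖≤κ√ρL}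
C√ρL/‖k‖ ≤ 14Cκ²√ρ·N ≤ N/16 for ρ small; hence n₀ ≥ N/2. [difficulty: M] -/
@[route_item "route-AtomisticToContinuum-BECGroundStateSOS", crux]
def IRModeCounting : Prop :=
  (∀ v : ℝ → ENNReal, Literature.MathematicalPhysics.QuantumManyBody.BoseGas.IsRepulsiveFiniteRange v → ∃ ρ₀ : ℝ, 0 < ρ₀ ∧ ∀ ρ : ℝ, 0 < ρ → ρ < ρ₀ → ∀ᶠ N : ℕ in Filter.atTop, Literature.MathematicalPhysics.QuantumManyBody.BoseGas.periodicGroundStateEnergy v N (Literature.MathematicalPhysics.QuantumManyBody.BoseGas.sideLength ρ N) ≠ ⊤) → (∀ v : ℝ → ENNReal, Literature.MathematicalPhysics.QuantumManyBody.BoseGas.IsRepulsiveFiniteRange v → ∀ κ : ℝ, 0 < κ → ∃ ρ₀ : ℝ, 0 < ρ₀ ∧ ∃ C : ℝ, 0 < C ∧ ∀ ρ : ℝ, 0 < ρ → ρ < ρ₀ → ∀ᶠ N : ℕ in Filter.atTop, ∃ δ : ENNReal, 0 < δ ∧ ∀ Ψ : Literature.MathematicalPhysics.QuantumManyBody.BoseGas.PeriodicTrialState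 N (Literature.MathematicalPhysics.QuantumManyBody.BoseGas.sideLength ρ N), Literature.MathematicalPhysics.QuantumManyBody.BoseGas.periodicEnergy v Ψ ≤ Literature.MathematicalPhysics.QuantumManyBody.BoseGas.periodicGroundStateEnergy v N (Literature.MathematicalPhysics.QuantumManyBody.BoseGas.sideLength ρ N) + δ → ∀ k : Fin 3 → ℤ, k ≠ 0 → ‖(fun j => (k j : ℝ))‖ ≤ κ * Real.sqrt ρ * Literature.MathematicalPhysics.QuantumManyBody.BoseGas.sideLength ρ N → Literature.MathematicalPhysics.QuantumManyBody.BoseGas.cellOccupation N (Literature.MathematicalPhysics.QuantumManyBody.BoseGas.sideLength ρ N) (fun x => ((Real.sqrt (Literature.MathematicalPhysics.QuantumManyBody.BoseGas.sideLength ρ N ^ 3))⁻¹ : ℂ) * Literature.MathematicalPhysics.QuantumManyBody.BoseGas.cellWave (Literature.MathematicalPhysics.QuantumManyBody.BoseGas.sideLength ρ N) k x) Ψ.ψ ≤ ENNReal.ofReal (C * Real.sqrt ρ * Literature.MathematicalPhysics.QuantumManyBody.BoseGas.sideLength ρ N / ‖(fun j => (k j : ℝ))‖)) → ∀ v : ℝ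 → ENNReal, Literature.MathematicalPhysics.QuantumManyBody.BoseGas.IsRepulsiveFiniteRange v → ∃ ρ₀ : ℝ, 0 < ρ₀ ∧ ∀ ρ : ℝ, 0 < ρ → ρ < ρ₀ → ∃ c : ℝ, 0 < c ∧ ∀ᶠ N : ℕ in Filter.atTop, ∃ δ : ENNReal, 0 < δ ∧ ∀ Ψ : Literature.MathematicalPhysics.QuantumManyBody.BoseGas.PeriodicTrialState N (Literature.MathematicalPhysics.QuantumManyBody.BoseGas.sideLength ρ N), Literature.MathematicalPhysics.QuantumManyBody.BoseGas.periodicEnergy v Ψ ≤ Literature.MathematicalPhysics.QuantumManyBody.BoseGas.periodicGroundStateEnergy v N (Literature.MathematicalPhysics.QuantumManyBody.BoseGas.sideLength ρ N) + δ → ENNReal.ofReal (c * N) ≤ Literature.MathematicalPhysics.QuantumManyBody.BoseGas.condensateOccupation N (Literature.MathematicalPhysics.QuantumManyBody.BoseGas.sideLength ρ N) Ψ.ψ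

-- earlier Assembly (stmt-AtomisticToContinuum-3975, replaced 2026-08-15T11:40:28Z -> stmt-AtomisticToContinuum-5246): retired by None — PeriodicEnergyFinite → PeriodicIRBound → IRModeCounting → BoundaryTransferWeak → Literature.MathematicalPhysics.QuantumManyBody.BoseGas.BoseEinsteinCondensation
/-- item stmt-AtomisticToContinuum-5246 · assembly · rank 1 · closed · proved by Summit.AtomisticToContinuum.BoseEinsteinCondensation.Theorems.assembly_proof @ 6606d10c17aa (prover) · by planner
sources: LSSY2005, KLS1988PRL
[assembly] PeriodicEnergyFinite → PeriodicIRBound → IRModeCounting → BoundaryTransferWeak →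
BoseEinsteinCondensation. -/
@[route_item "route-AtomisticToContinuum-BECGroundStateSOS", crux]
def Assembly : Prop :=
  PeriodicEnergyFinite → PeriodicIRBound → IRModeCounting → BoundaryTransferWeak → _root_.BoseEinsteinCondensation

/-! D-0027 §2.1 — DECIDING THEOREM (planner-authored via `route open/edit --closes-file`; by operator:999:377415 2026-08-15T14:36:31Z):
its hypotheses are this route's items and its conclusion the sub-problem Statement (glue_lint), and it elaborates with this file. -/

@[closes "route-AtomisticToContinuum-BECGroundStateSOS"] theorem closes : LatticeODLROOffHalfFilling → PeriodicIRBound → BoundaryTransferWeak → PeriodicEnergyFinite → IRModeCounting → Assembly → _root_.BoseEinsteinCondensation := fun h_LatticeODLROOffHalfFilling h_PeriodicIRBound h_BoundaryTransferWeak h_PeriodicEnergyFinite h_IRModeCounting h_Assembly => h_Assembly h_PeriodicEnergyFinite h_PeriodicIRBound h_IRModeCounting h_BoundaryTransferWeak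

end Summit.AtomisticToContinuum.BoseEinsteinCondensation.Theses.BECGroundStateSOS
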